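import Literature.NumberTheory.EllipticCurves.PAdicOneVariableNormCoherentUnitInduceMomentsOfCharacter
import Literature.NumberTheory.EllipticCurves.ProfiniteGroupDistributionDivisionAssembly
import HarnessLib

/-!
# `p = 2`, ABSTRACT TOWER: de Shalit II.4.6–4.7 + II.4.12 ASSEMBLED for units indexed in the norm-coherent
# units of the local Lubin–Tate tower — the measure `E` with `δ_{σ_𝔠,N𝔠} E = i(β_𝔠)` EXISTS and its
# moments are `∫_G κ^{k+1} dE = (κ(σ_𝔠)^{k+1} − N𝔠)⁻¹ · Σ_{c ∈ G/U_0} κ(r_c)^{k+1} δ̃_{k+1}(η(r_c⁻¹ • β_𝔠))`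

Topic `NumberTheory/EllipticCurves`; namespace `Literature.NumberTheory.EllipticCurves`.

De Shalit, *Iwasawa theory of elliptic curves with complex multiplication* (1987), II.4.12 Theorem (p. 66–69)
and II.4.7 (16)–(17) (p. 60).  This file is the COMPOSABILITY CERTIFICATE of the measure-side chain at `p = 2`:
`ProfiniteGroupDistributionDivisionAssembly.exists_twisting_μ_eq_forall_of_units` (the division, from an additive
`G`-equivariant `i : B → Λ(G)` and units with de Shalit's II.2.4 (ii) relation) is fed with
`i := GroupDistribution.induce D` of `PAdicOneVariableNormCoherentUnitFamilyOfCharacter.lean` (additivity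
`induce_μ_mul_of_character`, equivariance `induce_μ_smul_of_character`), along an abstract tower `(G, 𝒰, κ)` with
the cell hypotheses `hU`/`hκ`/`hψ`, the `G`-action on `B` reaching the local tower through `hη`; and the integrals
of the resulting `E` are computed by `integral_eq_of_units` + the coset formula
`integral_induce_character_pow_succ_of_character`:

* `induce_μ_smul_inv_of_character` — the equivariance in the form `i(g•b)(a) = i(b)(ḡ⁻¹ a)` consumed by the division;
* ★★★ `exists_twisting_μ_eq_forall_normCoherentUnits_of_character` — **∃ E on `G` along `𝒰`, `‖E‖ = C`, with
  `δ_{σ_𝔠,N𝔠} E = i(β_𝔠)` levelwise for every `𝔠`** (II.4.12 with all hypotheses displayed);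
* ★★★ `integral_character_pow_succ_of_twisting_eq_induce` — for any such `E` and any `𝔠` with
  `κ(σ_𝔠)^{k+1} ≠ N𝔠`: **`∫_G κ^{k+1} dE = (κ(σ_𝔠)^{k+1} − N𝔠)⁻¹ · Σ_{c ∈ 𝒰.cells 0} κ(r_c)^{k+1} · [S^0]D^k H_{η(r_c⁻¹ • β_𝔠)}`**
  (II.4.12 (29)↔(31) with II.4.7 (16)–(17): the moments of `μ(𝔣)` in terms of the Coleman logarithmic
  derivatives `δ̃_{k+1}` of the units — what II.4.7–4.10 / 4.14 then evaluate as Eisenstein numbers).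

Everything is proved; no named facts, no definitions, no instances (section-local instance attributes as in the
siblings), no `sorry`.

## References

* [deShalit1987] E. de Shalit, *Iwasawa theory of elliptic curves with complex multiplication* (1987),
  II.4.6 (14) (p. 59), II.4.7 (16)–(17) (p. 60), II.4.12 (29)–(33) (p. 66–69).
-/

noncomputable section

open MvPowerSeries Filter
open scoped Topology Classical

namespace Literature.NumberTheory.EllipticCurves

section DivisionAssemblyOfCharacter

open ValuativeRel IsLocalRing Field GroupDistribution
open Literature.NumberTheory.GaloisRepresentations Literature.NumberTheory.GaloisRepresentations.IsNonarchimedeanLocalField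
  Literature.NumberTheory.GaloisRepresentations.LubinTate Literature.NumberTheory.PAdicHodge

variable {F : Type} [Field F] [ValuativeRel F] [TopologicalSpace F] [IsNonarchimedeanLocalField F]

attribute [local instance] ltNormUniformSpace ltNormIsUniformAddGroup rk1 nF nE fintypeResidueField

variable (hq : residueFieldCard F = 2) (h2 : (valuation F).IsUniformizer (((2 : ℕ) : 𝒪[F]) : F))
  {σ₀ : absoluteGaloisGroup F} (hσ₀ : IsAbsArithFrob σ₀) (u : 𝒪[F]ˣ)
  {ε : (maxUnramifiedCompletion F)ˣ}
  (hε : maxUnramifiedCompletion.galAut F σ₀ (ε : maxUnramifiedCompletion F) =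
    algebraMap 𝒪[F] (maxUnramifiedCompletion F) (u : 𝒪[F]) * (ε : maxUnramifiedCompletion F))
variable (θ : CompletedAlgClosure F →+* ℂ_[2]) (hθc : Continuous θ)
  (hθ1 : ∀ z : CBall F, ‖θ (z : CompletedAlgClosure F)‖ ≤ 1)
  (hθζ : ∀ ζ' : ℂ_[2], (∃ n : ℕ, ζ' ^ 2 ^ n = 1) →
    ∃ ζ : CompletedAlgClosure F, (∃ n : ℕ, ζ ^ 2 ^ n = 1) ∧ θ ζ = ζ')
  (e : 𝒪[F] →+* ℤ_[2])
  (hΘe : ∀ a : 𝒪[F], (θ.comp ((CBall F).subtype.comp (algebraMap (UnrCoeff F) (CBall F)))) (intToUnrCoeff F a) =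
    padicIntCast ℂ_[2] (e a))
variable {G : Type*} [Group G] {𝒰 : SubgroupTower G} [∀ n, (𝒰.U n).Normal] (κ : G →* ℤ_[2]ˣ)
  (hU : ∀ (n : ℕ) (g : G), g ∈ 𝒰.U n ↔ g ∈ 𝒰.U 0 ∧ PadicInt.toZModPow (n + 1) (κ g : ℤ_[2]) = 1)
  (hκ : ∀ (n : ℕ) (w : ℤ_[2]ˣ), PadicInt.toZModPow 1 (w : ℤ_[2]) = 1 →
    ∃ g ∈ 𝒰.U 0, PadicInt.toZModPow (n + 1) (κ g : ℤ_[2]) = PadicInt.toZModPow (n + 1) (w : ℤ_[2]))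
  (ψ : (n : ℕ) → G ⧸ 𝒰.U n → ZMod (2 ^ (n + 1)))
  (hψ : ∀ (n : ℕ) (g : G), g ∈ 𝒰.U 0 → ψ n (𝒰.proj n g) = PadicInt.toZModPow (n + 1) (κ g : ℤ_[2]))
variable {B : Type*} [CommMonoid B] [MulDistribMulAction G B]
  (η : B → NormCoherentUnits (isUniformizer_unit_mul h2 u))
  (hη : ∀ g ∈ 𝒰.U 0, ∀ b : B, ∃ σ : absoluteGaloisGroup F, η (g • b) = (η b).galAct σ ∧
    Units.map (e : 𝒪[F] →* ℤ_[2]) (lubinTateChar (isUniformizer_unit_mul h2 u) σ) = κ g)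
  (hηmul : ∀ b b' : B, η (b * b') = (η b).mul (η b'))
  {C : ℝ}
  (hC : ∀ (b : B) (k : ℕ), ‖PowerSeries.coeff k ((PowerSeries.subst (compSeriesC h2 hσ₀ u hε)
          ((tildeSer ((u : 𝒪[F]) * ((2 : ℕ) : 𝒪[F])) (LTCoeff.of F (u : 𝒪[F])) (η b).logDeriv).map
            ((intToUnrCoeff F).comp (LTCoeff.of F).symm.toRingHom))).map (θ.comp ((CBall F).subtype.comp (algebraMap (UnrCoeff F) (CBall F)))))‖ ≤ C)
  (hC0 : 0 ≤ C)
  (hCb : ∀ b : B, (GroupDistribution.comap (restrictUnits ((invAmice₁ 2 ((PowerSeries.subst (compSeriesC h2 hσ₀ u hε)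
          ((tildeSer ((u : 𝒪[F]) * ((2 : ℕ) : 𝒪[F])) (LTCoeff.of F (u : 𝒪[F])) (η b).logDeriv).map
            ((intToUnrCoeff F).comp (LTCoeff.of F).symm.toRingHom))).map (θ.comp ((CBall F).subtype.comp (algebraMap (UnrCoeff F) (CBall F))))) (hC b)).density
          (ProfiniteTower.padicInt_isUniform 2) (unitInv ℂ_[2]) uniformContinuous_unitInv norm_unitInv_le))
          ψ (𝒰.cellMap_trans κ ψ hψ) (𝒰.cellMap_injective κ hU ψ hψ) (𝒰.cellMap_fiberSurj κ hU hκ ψ hψ)).bound ≤ C)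

include hq hΘe hη in
/-- The `G`-equivariance of `i := induce D` in the form the division step consumes:
`i(g • b)_n(a) = i(b)_n(ḡ⁻¹ a)`. [cite: deShalit1987, II.4.6 (14) (p. 59)] -/
theorem induce_μ_smul_inv_of_character (g : G) (b : B) (n : ℕ) (a : G ⧸ 𝒰.U n) :
    (GroupDistribution.induce (fun b ↦ (GroupDistribution.comap (restrictUnits ((invAmice₁ 2 ((PowerSeries.subst (compSeriesC h2 hσ₀ u hε)
          ((tildeSer ((u : 𝒪[F]) * ((2 : ℕ) : 𝒪[F])) (LTCoeff.of F (u : 𝒪[F])) (η b).logDeriv).map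
            ((intToUnrCoeff F).comp (LTCoeff.of F).symm.toRingHom))).map (θ.comp ((CBall F).subtype.comp (algebraMap (UnrCoeff F) (CBall F))))) (hC b)).density
          (ProfiniteTower.padicInt_isUniform 2) (unitInv ℂ_[2]) uniformContinuous_unitInv norm_unitInv_le))
          ψ (𝒰.cellMap_trans κ ψ hψ) (𝒰.cellMap_injective κ hU ψ hψ) (𝒰.cellMap_fiberSurj κ hU hκ ψ hψ))) hC0 hCb (g • b)).μ n a =
      (GroupDistribution.induce (fun b ↦ (GroupDistribution.comap (restrictUnits ((invAmice₁ 2 ((PowerSeries.subst (compSeriesC h2 hσ₀ u hε)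
          ((tildeSer ((u : 𝒪[F]) * ((2 : ℕ) : 𝒪[F])) (LTCoeff.of F (u : 𝒪[F])) (η b).logDeriv).map
            ((intToUnrCoeff F).comp (LTCoeff.of F).symm.toRingHom))).map (θ.comp ((CBall F).subtype.comp (algebraMap (UnrCoeff F) (CBall F))))) (hC b)).density
          (ProfiniteTower.padicInt_isUniform 2) (unitInv ℂ_[2]) uniformContinuous_unitInv norm_unitInv_le))
          ψ (𝒰.cellMap_trans κ ψ hψ) (𝒰.cellMap_injective κ hU ψ hψ) (𝒰.cellMap_fiberSurj κ hU hκ ψ hψ))) hC0 hCb b).μ n ((𝒰.proj n g)⁻¹ * a) := by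
  have h := induce_μ_smul_of_character hq h2 hσ₀ u hε (θ.comp ((CBall F).subtype.comp (algebraMap (UnrCoeff F) (CBall F)))) e hΘe κ hU hκ ψ hψ η hη hC hC0 hCb
    g b n ((𝒰.proj n g)⁻¹ * a)
  rwa [mul_inv_cancel_left] at h

variable {I : Type*} (hcomm : ∀ (n : ℕ) (x y : G), x * y * x⁻¹ * y⁻¹ ∈ 𝒰.U n)
  (β : I → B) (σ : I → G) (Nm : I → ℕ)
  (hrel : ∀ a c : I, σ c • β a * β c ^ Nm a = σ a • β c * β a ^ Nm c)

include hq hΘe hη hηmul hcomm hrel in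
/-- ★★★ **De Shalit II.4.12 along an abstract tower, units in the local Lubin–Tate tower**: given units
`β : I → B` with the relation II.2.4 (ii) `σ_𝔠•β_𝔞 · β_𝔠^{N𝔞} = σ_𝔞•β_𝔠 · β_𝔞^{N𝔠}`, Artin-type elements
`σ : I → G` and norms `Nm : I → ℕ`, and two indices `𝔞₁, 𝔞₂` satisfying the division hypotheses of
`exists_twisting_μ_eq_of_cocycle_natCast` (`σ_{𝔞ᵢ} ∈ U_s`, `σ_{𝔞₁}` generating `U_s` modulo every `U_n` with
`2`-power unbounded orders, `N𝔞₁ = N𝔞₂ ≥ 2`, `4 ∣ N𝔞₁ − 1`, `σ_{𝔞₂}^kσ_{𝔞₁}^{-k} ∉ ⋂ U_n`), **there is a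
bounded distribution `E` on `G` along `𝒰`, `‖E‖ = C`, with `δ_{σ_𝔠,N𝔠} E = i(β_𝔠)` levelwise for EVERY `𝔠`**,
`i := induce D` the measure of II.4.6 built from the log-free measures of the units.
[cite: deShalit1987, II.4.12 (p. 66–69), II.4.6 (14) (p. 59), II.2.4 (ii) (p. 43)] -/
theorem exists_twisting_μ_eq_forall_normCoherentUnits_of_character {s : ℕ} (a₁ a₂ : I)
    (hσ₁ : σ a₁ ∈ 𝒰.U s) (hσ₂ : σ a₂ ∈ 𝒰.U s)
    (hgen : ∀ m, s ≤ m → ∀ w ∈ 𝒰.U s, ∃ k : ℕ, 𝒰.proj m (σ a₁ ^ k) = 𝒰.proj m w)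
    (hpow : ∀ n, s ≤ n → ∃ r : ℕ, orderOf (𝒰.proj n (σ a₁)) = 2 ^ r)
    (hunb : ∀ r : ℕ, ∃ m, 2 ^ r ∣ orderOf (𝒰.proj m (σ a₁)))
    (hN1 : 2 ≤ Nm a₁) (h4 : 4 ∣ Nm a₁ - 1) (hN12 : Nm a₂ = Nm a₁)
    (hτ : ∀ k, 0 < k → ∃ n, s ≤ n ∧ σ a₂ ^ k * (σ a₁ ^ k)⁻¹ ∉ 𝒰.U n) :
    ∃ E : GroupDistribution 𝒰 ℂ_[2], E.bound = C ∧
      ∀ (c : I) (n : ℕ) (b : G ⧸ 𝒰.U n), (twisting (σ c) (Nm c : ℂ_[2]) E).μ n b =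
        (GroupDistribution.induce (fun b ↦ (GroupDistribution.comap (restrictUnits ((invAmice₁ 2 ((PowerSeries.subst (compSeriesC h2 hσ₀ u hε)
          ((tildeSer ((u : 𝒪[F]) * ((2 : ℕ) : 𝒪[F])) (LTCoeff.of F (u : 𝒪[F])) (η b).logDeriv).map
            ((intToUnrCoeff F).comp (LTCoeff.of F).symm.toRingHom))).map (θ.comp ((CBall F).subtype.comp (algebraMap (UnrCoeff F) (CBall F))))) (hC b)).density
          (ProfiniteTower.padicInt_isUniform 2) (unitInv ℂ_[2]) uniformContinuous_unitInv norm_unitInv_le))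
          ψ (𝒰.cellMap_trans κ ψ hψ) (𝒰.cellMap_injective κ hU ψ hψ) (𝒰.cellMap_fiberSurj κ hU hκ ψ hψ))) hC0 hCb (β c)).μ n b := by
  have h := exists_twisting_μ_eq_forall_of_units (p := 2) hcomm
    (fun b ↦ (GroupDistribution.induce (fun b ↦ (GroupDistribution.comap (restrictUnits ((invAmice₁ 2 ((PowerSeries.subst (compSeriesC h2 hσ₀ u hε)
          ((tildeSer ((u : 𝒪[F]) * ((2 : ℕ) : 𝒪[F])) (LTCoeff.of F (u : 𝒪[F])) (η b).logDeriv).map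
            ((intToUnrCoeff F).comp (LTCoeff.of F).symm.toRingHom))).map (θ.comp ((CBall F).subtype.comp (algebraMap (UnrCoeff F) (CBall F))))) (hC b)).density
          (ProfiniteTower.padicInt_isUniform 2) (unitInv ℂ_[2]) uniformContinuous_unitInv norm_unitInv_le))
          ψ (𝒰.cellMap_trans κ ψ hψ) (𝒰.cellMap_injective κ hU ψ hψ) (𝒰.cellMap_fiberSurj κ hU hκ ψ hψ))) hC0 hCb b))
    (fun g b n a ↦ induce_μ_smul_inv_of_character hq h2 hσ₀ u hε θ e hΘe κ hU hκ ψ hψ η hη hC hC0 hCb g b n a)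
    (fun b b' n a ↦ induce_μ_mul_of_character h2 hσ₀ u hε _ κ hU hκ ψ hψ η hC hηmul hC0 hCb b b' n a)
    β σ Nm hrel a₁ a₂ hσ₁ hσ₂ hgen hpow hunb hN1 (dvd_trans ⟨2, rfl⟩ h4) (fun _ ↦ h4) hN12 hτ
  simpa only [induce_bound] using h

include hq hθc hθ1 hθζ in
/-- ★★★ **The moments of de Shalit's measure in terms of Coleman logarithmic derivatives** (II.4.12 (29)↔(31)
with II.4.7 (16)–(17), along an abstract tower): if `δ_{σ_𝔠,N𝔠} E = i(β_𝔠)` levelwise for every `𝔠`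
(`exists_twisting_μ_eq_forall_normCoherentUnits_of_character`), then for every `𝔠` and `k` with
`κ(σ_𝔠)^{k+1} ≠ N𝔠`:
**`∫_G κ(g)^{k+1} dE(g) = (κ(σ_𝔠)^{k+1} − N𝔠)⁻¹ · Σ_{c ∈ G/U_0} κ(r_c)^{k+1} · [S^0]D^k H_{η(r_c⁻¹ • β_𝔠)}`**,
`H_γ = θ((δγ)~ ∘ ϑ)`, `r_c = 𝒰.repr 0 c`. [cite: deShalit1987, II.4.12 (29)–(31) (p. 67–69), II.4.7 (16)–(17) (p. 60)] -/
theorem integral_character_pow_succ_of_twisting_eq_induce (n₀ : ℕ) (E : GroupDistribution 𝒰 ℂ_[2])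
    (hE : ∀ (c : I) (n : ℕ) (b : G ⧸ 𝒰.U n), (twisting (σ c) (Nm c : ℂ_[2]) E).μ n b =
      (GroupDistribution.induce (fun b ↦ (GroupDistribution.comap (restrictUnits ((invAmice₁ 2 ((PowerSeries.subst (compSeriesC h2 hσ₀ u hε)
          ((tildeSer ((u : 𝒪[F]) * ((2 : ℕ) : 𝒪[F])) (LTCoeff.of F (u : 𝒪[F])) (η b).logDeriv).map
            ((intToUnrCoeff F).comp (LTCoeff.of F).symm.toRingHom))).map (θ.comp ((CBall F).subtype.comp (algebraMap (UnrCoeff F) (CBall F))))) (hC b)).density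
          (ProfiniteTower.padicInt_isUniform 2) (unitInv ℂ_[2]) uniformContinuous_unitInv norm_unitInv_le))
          ψ (𝒰.cellMap_trans κ ψ hψ) (𝒰.cellMap_injective κ hU ψ hψ) (𝒰.cellMap_fiberSurj κ hU hκ ψ hψ))) hC0 hCb (β c)).μ n b)
    (c : I) (k : ℕ) (hne : padicIntCast ℂ_[2] ((κ (σ c) : ℤ_[2]) ^ (k + 1)) ≠ (Nm c : ℂ_[2])) :
    E.integral (fun g ↦ padicIntCast ℂ_[2] ((κ g : ℤ_[2]) ^ (k + 1))) =
      (padicIntCast ℂ_[2] ((κ (σ c) : ℤ_[2]) ^ (k + 1)) - (Nm c : ℂ_[2]))⁻¹ *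
        ∑ c' ∈ 𝒰.cells 0, padicIntCast ℂ_[2] ((κ (𝒰.repr 0 c') : ℤ_[2]) ^ (k + 1)) *
          PowerSeries.constantCoeff (mahlerD^[k] ((PowerSeries.subst ((compSeriesC h2 hσ₀ u hε).map (algebraMap (UnrCoeff F) (CBall F)))
          ((tildeSer ((u : 𝒪[F]) * ((2 : ℕ) : 𝒪[F])) (LTCoeff.of F (u : 𝒪[F])) (η ((𝒰.repr 0 c')⁻¹ • β c)).logDeriv).map
            ((algebraMap (UnrCoeff F) (CBall F)).comp
              ((intToUnrCoeff F).comp (LTCoeff.of F).symm.toRingHom)))).map (θ.comp (CBall F).subtype))) := by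
  rw [integral_eq_of_units (p := 2) (fun b ↦ (GroupDistribution.induce (fun b ↦ (GroupDistribution.comap (restrictUnits ((invAmice₁ 2 ((PowerSeries.subst (compSeriesC h2 hσ₀ u hε)
          ((tildeSer ((u : 𝒪[F]) * ((2 : ℕ) : 𝒪[F])) (LTCoeff.of F (u : 𝒪[F])) (η b).logDeriv).map
            ((intToUnrCoeff F).comp (LTCoeff.of F).symm.toRingHom))).map (θ.comp ((CBall F).subtype.comp (algebraMap (UnrCoeff F) (CBall F))))) (hC b)).density
          (ProfiniteTower.padicInt_isUniform 2) (unitInv ℂ_[2]) uniformContinuous_unitInv norm_unitInv_le))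
          ψ (𝒰.cellMap_trans κ ψ hψ) (𝒰.cellMap_injective κ hU ψ hψ) (𝒰.cellMap_fiberSurj κ hU hκ ψ hψ))) hC0 hCb b))
    β σ Nm E hE c (SubgroupTower.isTowerContinuous_padicIntCast_character_pow κ hU (k + 1))
    (fun x y ↦ by rw [map_mul, Units.val_mul, mul_pow, map_mul]) (by rw [map_one, Units.val_one, one_pow, map_one]) hne,
    integral_induce_character_pow_succ_of_character hq h2 hσ₀ u hε θ hθc hθ1 hθζ κ hU hκ ψ hψ η hC hC0 hCb n₀ (β c) k]

end DivisionAssemblyOfCharacter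

end Literature.NumberTheory.EllipticCurves

end
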